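import Mathlib
import HarnessLib
import Literature.Analysis.FluidPDE.TypeIAncientMild
import Literature.Analysis.FluidPDE.LocalTypeIScaling
import Literature.Analysis.FluidPDE.ClassicalSolutionRescale
import Summits.NavierStokesRegularity.NavierStokesRegularity.Theorems.SqueezeCycleExtremalElementExistsRescale

/-!
# `SymmetryModuliCount.ForcedSymmetry` (crux stmt-NavierStokesRegularity-4052), line
# `recurrent-closing`, stub `stub_oscAllScales`: from the unit scale to all scales

Support file (everything proved, kind = proof) for the lead's skeleton of the line
`recurrent-closing` (`Cruxes/ForcedSymmetry/Lines/recurrent_closing.lean`), sub-stub 1d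
`stub_oscAllScales`.

The class `A_C ∩ {ledger K}` of Type-I ancient KNSS-mild fields `u` (`IsTypeIAncientMild C u`)
carrying the far-past energy ledger `∫_{B_R(x₀)} |u(t)|² ≤ K R` (`t < 0`, `R > 0`), together with
their classical pressures on `(−∞, 0)`, is invariant under the Navier–Stokes zoom
`u ↦ r u(z.1 + r² s, z.2 + r y)`, `p ↦ r² p(z.1 + r² s, z.2 + r y)` about any centre `z` with
`z.1 ≤ 0` (`isTypeIAncientMild_zoom` after the backward time shift
`IsTypeIAncientMild.comp_sub_right`; `scaledEnergy_zoom`;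
`IsClassicalNSSolutionOn.nsRescale_translate_zero`), and Albritton–Barker's mean-free pressure
quantity `D_osc` is scale invariant (`cknDOsc_nsZoom`): `D_osc(Q(0,1); r² p ∘ Φ) = D_osc(Q(z,r); p)`.
Hence a bound `D_osc(Q(z, 1); q) ≤ D₁` at the unit scale, uniform over the class, all its
classical pressures and all centres with top time `≤ 0`, gives the same bound on every parabolic
ball `Q(z, r)`, `r > 0`, `z.1 ≤ 0`.

## References

* D. Albritton, T. Barker, *Global weak Besov solutions of the Navier–Stokes equations and
  applications*, Arch. Ration. Mech. Anal. 232 (2019), §3 (scaling of `A, C, D, E`).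
  [AlbrittonBarker2019]
* G. Koch, N. Nadirashvili, G. Seregin, V. Šverák, *Liouville theorems for the Navier–Stokes
  equations and applications*, Acta Math. 203 (2009), §1 and §6 (6.2) (symmetries of the
  class). [KochNadirashviliSereginSverak2009]
-/

noncomputable section

-- the summit and its single problem share the name (D-0017 nested layout)
set_option linter.dupNamespace false

open MeasureTheory Set Metric Function
open scoped ENNReal

namespace Summit.NavierStokesRegularity.NavierStokesRegularity.Theorems.SymmetryModuliCountForcedSymmetry

open Literature.Analysis.FluidPDE

/-- The zoom about `(t₀, x₀)` is the zoom about `(0, x₀)` of the field shifted backward in time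
by `-t₀`: `c u(t₀ + c² s, x₀ + c y) = c w(c² s, x₀ + c y)` with `w(t) = u(t - (-t₀))`. -/
theorem zoom_timeShift_eq (c t₀ : ℝ) (x₀ : EuclideanSpace ℝ (Fin 3))
    (u : ℝ → EuclideanSpace ℝ (Fin 3) → EuclideanSpace ℝ (Fin 3)) :
    (c • stPull (c ^ 2) c 0 x₀ fun t => u (t - -t₀)) = c • stPull (c ^ 2) c t₀ x₀ u := by
  funext s y
  simp only [Pi.smul_apply, stPull_apply]
  rw [show (0 : ℝ) + c ^ 2 * s - -t₀ = t₀ + c ^ 2 * s by ring]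

/-- **The far-past energy ledger is zoom invariant**: if `∫_{B_R(x₀)} |u(t)|² ≤ K R` for all
`t < 0`, `x₀`, `R > 0`, then the zoom `r u(t₀ + r² s, y₀ + r y)` about a centre with `t₀ ≤ 0`
carries the same ledger (substitution `x = y₀ + r y`: `scaledEnergy_zoom`). -/
theorem ledger_zoom {K : ℝ} {u : ℝ → EuclideanSpace ℝ (Fin 3) → EuclideanSpace ℝ (Fin 3)}
    (hK : ∀ t < 0, ∀ (x₀ : EuclideanSpace ℝ (Fin 3)) (R : ℝ), 0 < R →
      ∫ x in ball x₀ R, ‖u t x‖ ^ 2 ≤ K * R)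
    {r : ℝ} (hr : 0 < r) {t₀ : ℝ} (ht₀ : t₀ ≤ 0) (y₀ : EuclideanSpace ℝ (Fin 3)) :
    ∀ t < 0, ∀ (x₀ : EuclideanSpace ℝ (Fin 3)) (R : ℝ), 0 < R →
      ∫ x in ball x₀ R, ‖(r • stPull (r ^ 2) r t₀ y₀ u) t x‖ ^ 2 ≤ K * R := by
  intro t ht x₀ R hR
  have hrR : 0 < r * R := mul_pos hr hR
  have ht2 : r ^ 2 * t < 0 := mul_neg_of_pos_of_neg (pow_pos hr 2) ht
  have ht' : r ^ 2 * t - -t₀ < 0 := by linarith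
  have h1 := scaledEnergy_zoom hr y₀ x₀ (fun t => u (t - -t₀)) t hR
  rw [zoom_timeShift_eq] at h1
  have h2 : ∫ x in ball (y₀ + r • x₀) (r * R), ‖u (r ^ 2 * t - -t₀) x‖ ^ 2 ≤ K * (r * R) :=
    hK _ ht' _ _ hrR
  have h3 : R⁻¹ * ∫ x in ball x₀ R, ‖(r • stPull (r ^ 2) r t₀ y₀ u) t x‖ ^ 2 ≤ K := by
    rw [h1]
    calc (r * R)⁻¹ * ∫ x in ball (y₀ + r • x₀) (r * R), ‖u (r ^ 2 * t - -t₀) x‖ ^ 2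
        ≤ (r * R)⁻¹ * (K * (r * R)) := mul_le_mul_of_nonneg_left h2 (inv_nonneg.2 hrR.le)
      _ = K := by field_simp
  calc ∫ x in ball x₀ R, ‖(r • stPull (r ^ 2) r t₀ y₀ u) t x‖ ^ 2
      = R * (R⁻¹ * ∫ x in ball x₀ R, ‖(r • stPull (r ^ 2) r t₀ y₀ u) t x‖ ^ 2) := by
        rw [← mul_assoc, mul_inv_cancel₀ hR.ne', one_mul]
    _ ≤ R * K := mul_le_mul_of_nonneg_left h3 hR.le
    _ = K * R := mul_comm _ _

/-- **Sub-stub 1d — from the unit scale to all scales (invariance of the ledger class).**  If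
every classical pressure `q` on `(−∞,0)` of every `v ∈ A_C` carrying the ledger with constant `K`
satisfies `D_osc(Q(z,1); q) ≤ D₁` at every centre `z` with `z.1 ≤ 0`, then for such `(u, p)` the
same bound holds on EVERY parabolic ball of the slab: `D_osc(Q(z,r); p) ≤ D₁`, `r > 0`,
`z.1 ≤ 0`.  The zoom `r u(z.1 + r²s, z.2 + r y)` (pressure `r² p(…)`) is again in `A_C` with
ledger `K` (`isTypeIAncientMild_zoom`, `IsTypeIAncientMild.comp_sub_right`, `scaledEnergy_zoom`)
and classical on `(−∞,0)` (`IsClassicalNSSolutionOn.nsRescale_translate_zero`), and `D_osc` is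
invariant (`cknDOsc_nsZoom`).
[cite: AlbrittonBarker2019, §3 (scaling); KochNadirashviliSereginSverak2009, §6 (6.2)] -/
theorem stub_oscAllScales :
    ∀ (C K D₁ : ℝ),
      (∀ (v : ℝ → EuclideanSpace ℝ (Fin 3) → EuclideanSpace ℝ (Fin 3)) (q : ℝ → EuclideanSpace ℝ (Fin 3) → ℝ),
        IsTypeIAncientMild C v →
        (∀ t < 0, ∀ (x₀ : EuclideanSpace ℝ (Fin 3)) (R : ℝ), 0 < R → ∫ x in ball x₀ R, ‖v t x‖ ^ 2 ≤ K * R) →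
        IsClassicalNSSolutionOn (Set.Iio 0) 1 0 v q →
        ∀ z : ℝ × EuclideanSpace ℝ (Fin 3), z.1 ≤ 0 → cknDOsc 1 z q ≤ ENNReal.ofReal D₁) →
      ∀ (u : ℝ → EuclideanSpace ℝ (Fin 3) → EuclideanSpace ℝ (Fin 3)) (p : ℝ → EuclideanSpace ℝ (Fin 3) → ℝ),
        IsTypeIAncientMild C u →
        (∀ t < 0, ∀ (x₀ : EuclideanSpace ℝ (Fin 3)) (R : ℝ), 0 < R → ∫ x in ball x₀ R, ‖u t x‖ ^ 2 ≤ K * R) →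
        IsClassicalNSSolutionOn (Set.Iio 0) 1 0 u p →
        ∀ (r : ℝ), 0 < r → ∀ z : ℝ × EuclideanSpace ℝ (Fin 3), z.1 ≤ 0 → cknDOsc r z p ≤ ENNReal.ofReal D₁ := by
  intro C K D₁ H u p hu hK hp r hr z hz
  -- (1) scale invariance of `D_osc`: `D_osc(Q(0, 1); r² p ∘ Φ) = D_osc(Q(z, r); p)`
  have hz0 : stAffine (r ^ 2) r z.1 z.2 (0 : ℝ × EuclideanSpace ℝ (Fin 3)) = z :=
    Prod.ext (by simp) (by simp)
  have hD := cknDOsc_nsZoom (c := r) (r := 1) hr one_pos z.1 z.2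
    (0 : ℝ × EuclideanSpace ℝ (Fin 3)) p
  rw [mul_one, hz0] at hD
  rw [← hD]
  refine H (r • stPull (r ^ 2) r z.1 z.2 u) (r ^ 2 • stPull (r ^ 2) r z.1 z.2 p) ?_
    (ledger_zoom hK hr hz z.2) ?_ 0 (by simp)
  · -- (2) the zoom stays in the class `A_C`
    rw [← zoom_timeShift_eq]
    exact isTypeIAncientMild_zoom (hu.comp_sub_right (neg_nonneg.2 hz)) hr z.2
  · -- (4) the zoomed pair is classical on `(−∞, 0)`
    refine (hp.nsRescale_translate_zero hr z.1 z.2).mono (fun s hs => ?_) isOpen_Iio.uniqueDiffOn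
    have hs2 : r ^ 2 * s < 0 := mul_neg_of_pos_of_neg (pow_pos hr 2) hs
    show z.1 + r ^ 2 * s < 0
    linarith

end Summit.NavierStokesRegularity.NavierStokesRegularity.Theorems.SymmetryModuliCountForcedSymmetry

end
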